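import Summits.CriticalPhenomena.PercolationContinuityZ3.Theorems.Transplant.SkelNegBParamsFaceFloorsPinYA
import HarnessLib

/-!
# N1 params, M3′ groups G-π′ RESTATED AT THE y′-FACE ORIGIN SIZE (p3-g12 LOCATED 2026-08-22T10:38:35Z, p5-g12 concur 10:38:59Z): the landing
# origins of record `yLFs/d/t` have `|yL|₁ ≤ YbF + n_L + |h_L| + 1 ≤ YbF + 11·n_L` (α = σh·(2n_L + nBF − RA′) + σ·v_L), NOT `≤ YbF` (which was sized
# for the x-face origins), so the origin hypothesis of `hπ2Y_YA_gen/hπ3Y_YA_gen` (ZPiYA p323912) and `hπ2Y_YA/hπ3Y_YA` (PinYA p325677) is re-stated as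
# **`hyl : |yL 0|.natAbs + |yL 1|.natAbs ≤ YbF + 11·n_L`** — budget-neutral: the `11·n_L` is absorbed by `exR2 ≥ Yb + 11055·n_L + …` (new budget
# `clr_floorπY_exA₂`); the old declarations stay valid (p1-g14, 2026-08-22; new names, nothing retracted).
* `clr_floorπY_exA₂`, **`hπ2Y_YA_gen₂`**, **`hπ3Y_YA_gen₂`** (generic `Nr N₃`), **`hπ2Y_YA₂`**, **`hπ3Y_YA₂`** (pinned at `NrY/N3Y`).
builds on p205010 (kernel theorem, internal audit signed; external expert review pending) — nothing in this file uses p205010; NOTHING is claimed about the node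
`SamePDropOfSkeletonNeg₁` (OPEN); arithmetic only.
Lane `prim-bschramm-*`, seat `prim-bschramm-p1` (gen 14); helper file (`--supports stmt-CriticalPhenomena-4575 --as helper`); slot-ledger ζ′ v1–v3 (ex-monotone).
[cite: KozmaNitzan2024, §4 Lemma 12 (pp. 23–25)] [cite: MartineauTassion2017, §4.3 Lemma 4.2]
-/

noncomputable section

open scoped Classical

namespace Summit.CriticalPhenomena.PercolationContinuityZ3.Theorems.Transplant

namespace PlanarSkeletonNeg

namespace NegB

open Literature.Probability.Percolation Literature.Probability.LatticeModels SimpleGraph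
open Literature.Probability.Percolation.KozmaNitzan.Cells (oth sgOf sgOf_sign)
open SkelConc (Consts)
open Skelφ (shearUnit shearUnit_pos crossOffY yPrmW)
open Skelφ.StepI (DataN)
open TwoAxis.Para (modulus)
open Neg

namespace KS

section PiY2

variable (κ : Consts) {V : Type} [DecidableEq V] [Countable V] {G : SimpleGraph V} [G.LocallyFinite] (Φ : PlanarSkeletonNeg G) (t : V)
  (p : unitInterval) (D : DataN V) (c mk g f : ℕ)

/-- **THE y′-FACE G-π BUDGET WITH THE ORIGIN'S EXTRA `11·n_L`**: `YbF + 11·n_L + 1000·Kq·U + 11000·Kq·n_L + 1000·Kq·ℓ_L + 13 + 1 ≤ exA`. [folklore] -/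
theorem clr_floorπY_exA₂ (hκ : (hL κ Φ t p D g f).natAbs ≤ 10 * nL κ Φ t p D g f) (hSF : 16 * SF κ Φ t p D c mk ≤ ML κ Φ t p D g)
    (hnA : 2000 * Neg.Kq κ * (RA' κ Φ t p D mk + 2) ≤ nL κ Φ t p D g f) :
    YbF κ Φ t p D c mk g f + 11 * nL κ Φ t p D g f + 1000 * Neg.Kq κ * shearUnit (nL κ Φ t p D g f) (hL κ Φ t p D g f) + 11000 * Neg.Kq κ * nL κ Φ t p D g f +
        1000 * Neg.Kq κ * ℓL κ Φ t p D g f + 13 + 1 ≤ exA κ Φ t p D g f := by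
  have hY := clr_YbF_le κ Φ t p D c mk g f hκ hSF hnA
  have hq := Neg.one_le_Kq κ
  have hex := (exR_le_exR2 κ Φ t p D g f).2
  have hn1 : 1 ≤ nL κ Φ t p D g f := by have := (ML_lt_nL κ Φ t p D g f).1; omega
  have e : exA κ Φ t p D g f = exR2 κ Φ t p D g f +
      Neg.Kq κ * (Yb κ Φ t p D g f + 1000 * shearUnit (nL κ Φ t p D g f) (hL κ Φ t p D g f) + 11055 * nL κ Φ t p D g f + 1000 * ℓL κ Φ t p D g f + 20) +
      exCA κ Φ t p D g f := rfl
  rw [e, Nat.mul_add, Nat.mul_add, Nat.mul_add, Nat.mul_add]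
  have e2 : Neg.Kq κ * (1000 * shearUnit (nL κ Φ t p D g f) (hL κ Φ t p D g f)) = 1000 * (Neg.Kq κ * shearUnit (nL κ Φ t p D g f) (hL κ Φ t p D g f)) := by ring
  have e3 : Neg.Kq κ * (11055 * nL κ Φ t p D g f) = 11055 * (Neg.Kq κ * nL κ Φ t p D g f) := by ring
  have e4 : Neg.Kq κ * (1000 * ℓL κ Φ t p D g f) = 1000 * (Neg.Kq κ * ℓL κ Φ t p D g f) := by ring
  have e5 : 11000 * Neg.Kq κ * nL κ Φ t p D g f = 11000 * (Neg.Kq κ * nL κ Φ t p D g f) := by ring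
  have e7 : 1000 * Neg.Kq κ * shearUnit (nL κ Φ t p D g f) (hL κ Φ t p D g f) = 1000 * (Neg.Kq κ * shearUnit (nL κ Φ t p D g f) (hL κ Φ t p D g f)) := by ring
  have e8 : 1000 * Neg.Kq κ * ℓL κ Φ t p D g f = 1000 * (Neg.Kq κ * ℓL κ Φ t p D g f) := by ring
  have hn : nL κ Φ t p D g f ≤ Neg.Kq κ * nL κ Φ t p D g f := Nat.le_mul_of_pos_left _ hq
  rw [e2, e3, e4, e5, e7, e8]
  omega

/-- **M3 y′-face field `hπ2Y`, generic, origin size `YbF + 11·n_L`.** [cite: KozmaNitzan2024, §4 Lemma 12 (pp. 23–25)] -/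
theorem hπ2Y_YA_gen₂ (hN : EqNumL κ Φ t p D g f) (hκ : (hL κ Φ t p D g f).natAbs ≤ 10 * nL κ Φ t p D g f)
    (hnA : 2000 * Neg.Kq κ * (RA' κ Φ t p D mk + 2) ≤ nL κ Φ t p D g f) (hℓA : 22000 * Neg.Kq κ * (RA' κ Φ t p D mk + 2) ≤ ℓL κ Φ t p D g f)
    (hSF : 16 * SF κ Φ t p D c mk ≤ ML κ Φ t p D g) (yL : Site 2) (hyl : (yL 0).natAbs + (yL 1).natAbs ≤ YbF κ Φ t p D c mk g f + 11 * nL κ Φ t p D g f)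
    {Nr : ℕ} (hNr : Nr + 1 ≤ 1000 * Neg.Kq κ) (qB : ℕ) (r : ℕ) (hr : ∀ X : ℕ, X + 1 ≤ exA κ Φ t p D g f → X ≤ r) :
    ∀ k ≤ Nr, ((yL 0).natAbs + (yL 1).natAbs) + (((((k + 1 : ℕ) : ℤ) * vL κ Φ t p D g f).natAbs +
      (((shearUnit (nL κ Φ t p D g f) (hL κ Φ t p D g f) : ℤ) * |((k + 1 : ℕ) : ℤ) * (yPrmW (nL κ Φ t p D g f) (ℓL κ Φ t p D g f) (hL κ Φ t p D g f) (vL κ Φ t p D g f) (RA' κ Φ t p D mk) qB Nr).sLo| +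
        |hL κ Φ t p D g f| * |((k + 1 : ℕ) : ℤ) * vL κ Φ t p D g f| + shearUnit (nL κ Φ t p D g f) (hL κ Φ t p D g f)) / nL κ Φ t p D g f).natAbs + 1)) ≤ r := by
  intro k hk
  obtain ⟨hn1, -⟩ := one_le_of_eqNumL κ Φ t p D g f hN
  have hn0 : (0 : ℤ) < (nL κ Φ t p D g f : ℤ) := by exact_mod_cast hn1
  have hU := shearUnit_pos hn1 (hL κ Φ t p D g f)
  obtain ⟨-, hU2⟩ := clr_shearUnit_bounds κ Φ t p D g f hκ
  have hκ' : |hL κ Φ t p D g f| ≤ 10 * (nL κ Φ t p D g f : ℤ) := by rw [← Int.natCast_natAbs]; exact_mod_cast hκ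
  have hq1 : 1 ≤ Neg.Kq κ := Neg.one_le_Kq κ
  have hℓ11 : (11 : ℤ) ≤ (ℓL κ Φ t p D g f : ℤ) := by
    have h2 : 1 * (0 + 2) ≤ Neg.Kq κ * (RA' κ Φ t p D mk + 2) := Nat.mul_le_mul hq1 (by omega)
    have : 11 ≤ ℓL κ Φ t p D g f := by nlinarith only [hℓA, h2]
    exact_mod_cast this
  have hnℓ : (nL κ Φ t p D g f : ℤ) * 11 ≤ (nL κ Φ t p D g f : ℤ) * ℓL κ Φ t p D g f := mul_le_mul_of_nonneg_left hℓ11 hn0.le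
  have hsLo : (yPrmW (nL κ Φ t p D g f) (ℓL κ Φ t p D g f) (hL κ Φ t p D g f) (vL κ Φ t p D g f) (RA' κ Φ t p D mk) qB Nr).sLo = sLoY κ Φ t p D g f := rfl
  rw [hsLo]
  have sL' : (shearUnit (nL κ Φ t p D g f) (hL κ Φ t p D g f) : ℤ) * sLoY κ Φ t p D g f ≤
      (nL κ Φ t p D g f : ℤ) * ℓL κ Φ t p D g f - (shearUnit (nL κ Φ t p D g f) (hL κ Φ t p D g f) : ℤ) + 1 := by unfold sLoY; exact Int.mul_ediv_self_le hU.ne'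
  have hs0 : 0 ≤ sLoY κ Φ t p D g f := by unfold sLoY; exact Int.ediv_nonneg (by linarith only [hU2, hnℓ]) hU.le
  have hk1 : ((k + 1 : ℕ) : ℤ) ≤ 1000 * (Neg.Kq κ : ℤ) := by
    have h3 : k + 1 ≤ 1000 * Neg.Kq κ := by omega
    exact_mod_cast h3
  have hterm := clr_kterm_le hn1 hN.v_le hκ' hU2 hs0 (by linarith only [sL', hU]) (by positivity : (0 : ℤ) ≤ (ℓL κ Φ t p D g f : ℤ))
    (Nat.cast_nonneg _ : (0 : ℤ) ≤ ((k + 1 : ℕ) : ℤ)) hk1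
  have hNn0 : 0 ≤ (shearUnit (nL κ Φ t p D g f) (hL κ Φ t p D g f) : ℤ) * |((k + 1 : ℕ) : ℤ) * sLoY κ Φ t p D g f| +
      |hL κ Φ t p D g f| * |((k + 1 : ℕ) : ℤ) * vL κ Φ t p D g f| + (shearUnit (nL κ Φ t p D g f) (hL κ Φ t p D g f) : ℤ) := by
    have a1 := mul_nonneg hU.le (abs_nonneg (((k + 1 : ℕ) : ℤ) * sLoY κ Φ t p D g f))
    have a2 := mul_nonneg (abs_nonneg (hL κ Φ t p D g f)) (abs_nonneg (((k + 1 : ℕ) : ℤ) * vL κ Φ t p D g f))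
    linarith only [a1, a2, hU]
  have hdiv0 := Int.ediv_nonneg hNn0 hn0.le
  have hfl := clr_floorπY_exA₂ κ Φ t p D c mk g f hκ hSF hnA
  refine hr _ (le_trans ?_ hfl)
  rw [← Nat.cast_le (α := ℤ)] at hyl ⊢
  push_cast at hdiv0 hterm
  push_cast [Int.natCast_natAbs] at hyl ⊢
  rw [abs_of_nonneg hdiv0]
  have hU0' : (0 : ℤ) ≤ 1000 * (Neg.Kq κ : ℤ) * (shearUnit (nL κ Φ t p D g f) (hL κ Φ t p D g f) : ℤ) := by positivity
  linarith only [hyl, hterm, hU0']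

/-- **M3 y′-face field `hπ3Y`, generic, origin size `YbF + 11·n_L`.** [cite: KozmaNitzan2024, §4 Lemma 12 (pp. 23–25)] -/
theorem hπ3Y_YA_gen₂ (hN : EqNumL κ Φ t p D g f) (hκ : (hL κ Φ t p D g f).natAbs ≤ 10 * nL κ Φ t p D g f)
    (hnA : 2000 * Neg.Kq κ * (RA' κ Φ t p D mk + 2) ≤ nL κ Φ t p D g f) (hℓA : 22000 * Neg.Kq κ * (RA' κ Φ t p D mk + 2) ≤ ℓL κ Φ t p D g f)
    (hSF : 16 * SF κ Φ t p D c mk ≤ ML κ Φ t p D g) (du : MDir) (yL : Site 2) (hyl : (yL 0).natAbs + (yL 1).natAbs ≤ YbF κ Φ t p D c mk g f + 11 * nL κ Φ t p D g f)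
    {Nr N₃ : ℕ} (hNr : Nr + 1 ≤ 1000 * Neg.Kq κ) (hN₃ : N₃ + 1 ≤ 1000 * Neg.Kq κ) (r : ℕ) (hr : ∀ X : ℕ, X + 1 ≤ exA κ Φ t p D g f → X ≤ r) :
    (((yL + crossOffY (nL κ Φ t p D g f) (ℓL κ Φ t p D g f) (hL κ Φ t p D g f) (vL κ Φ t p D g f) (sgOf du) Nr) 0).natAbs +
        ((yL + crossOffY (nL κ Φ t p D g f) (ℓL κ Φ t p D g f) (hL κ Φ t p D g f) (vL κ Φ t p D g f) (sgOf du) Nr) 1).natAbs) +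
      (N₃ + 1) * shearUnit (nL κ Φ t p D g f) (hL κ Φ t p D g f) ≤ r := by
  have hT := clr_crossOffY_l1 κ Φ t p D mk g f hN hκ hℓA yL (sgOf_sign du) Nr
  have hfl := clr_floorπY_exA₂ κ Φ t p D c mk g f hκ hSF hnA
  refine hr _ (le_trans ?_ hfl)
  have h1 : (Nr + 1) * (11 * nL κ Φ t p D g f + ℓL κ Φ t p D g f) ≤ 1000 * Neg.Kq κ * (11 * nL κ Φ t p D g f + ℓL κ Φ t p D g f) :=
    Nat.mul_le_mul_right _ hNr
  have h2 : (N₃ + 1) * shearUnit (nL κ Φ t p D g f) (hL κ Φ t p D g f) ≤ 1000 * Neg.Kq κ * shearUnit (nL κ Φ t p D g f) (hL κ Φ t p D g f) :=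
    Nat.mul_le_mul_right _ hN₃
  have e1 : 1000 * Neg.Kq κ * (11 * nL κ Φ t p D g f + ℓL κ Φ t p D g f) = 11000 * Neg.Kq κ * nL κ Φ t p D g f + 1000 * Neg.Kq κ * ℓL κ Φ t p D g f := by ring
  omega

/-- **M3 y′-face field `hπ2Y` at hp-8's counts, origin size `YbF + 11·n_L`** (`Nr := NrY`). [cite: KozmaNitzan2024, §4 Lemma 12 (pp. 23–25)] -/
theorem hπ2Y_YA₂ (hN : EqNumL κ Φ t p D g f) (hκ : (hL κ Φ t p D g f).natAbs ≤ 10 * nL κ Φ t p D g f)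
    (hnA : 2000 * Neg.Kq κ * (RA' κ Φ t p D mk + 2) ≤ nL κ Φ t p D g f) (hℓA : 22000 * Neg.Kq κ * (RA' κ Φ t p D mk + 2) ≤ ℓL κ Φ t p D g f)
    (hSF : 16 * SF κ Φ t p D c mk ≤ ML κ Φ t p D g)
    (x : Site 2) (du : MDir) (hd : du.1 = 1) (j : ℕ) (hj : j < (fcellsA κ Φ t p D g f).K) (z : Site 2) {E : ℕ}
    (hlev1 : (fcellsA κ Φ t p D g f).faceL 1 j - E ≤ (fcellsA κ Φ t p D g f).lev du x z) (hlev2 : (fcellsA κ Φ t p D g f).lev du x z ≤ (fcellsA κ Φ t p D g f).faceL 1 j + E)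
    (hEu : (E : ℤ) ≤ u₁A κ Φ t p D g f) (yL : Site 2) (he1 : |F1cA κ Φ t p D g f yL| ≤ 6 * u₁A κ Φ t p D g f)
    (hyl : (yL 0).natAbs + (yL 1).natAbs ≤ YbF κ Φ t p D c mk g f + 11 * nL κ Φ t p D g f) (qB : ℕ) (r : ℕ) (hr : ∀ X : ℕ, X + 1 ≤ exA κ Φ t p D g f → X ≤ r) :
    ∀ k ≤ NrY κ Φ t p D g f yL x du z, ((yL 0).natAbs + (yL 1).natAbs) + (((((k + 1 : ℕ) : ℤ) * vL κ Φ t p D g f).natAbs +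
      (((shearUnit (nL κ Φ t p D g f) (hL κ Φ t p D g f) : ℤ) * |((k + 1 : ℕ) : ℤ) * (yPrmW (nL κ Φ t p D g f) (ℓL κ Φ t p D g f) (hL κ Φ t p D g f) (vL κ Φ t p D g f) (RA' κ Φ t p D mk) qB (NrY κ Φ t p D g f yL x du z)).sLo| +
        |hL κ Φ t p D g f| * |((k + 1 : ℕ) : ℤ) * vL κ Φ t p D g f| + shearUnit (nL κ Φ t p D g f) (hL κ Φ t p D g f)) / nL κ Φ t p D g f).natAbs + 1)) ≤ r := by
  have hu1 : 1 ≤ u₁A κ Φ t p D g f := (units_eqA κ Φ t p D g f).2.2.2.2.2.2.2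
  obtain ⟨-, hNr⟩ := NrY_range κ Φ t p D g f x du hd z hj hlev1 hlev2 yL he1 (by linarith)
  have hNr' : NrY κ Φ t p D g f yL x du z + 1 ≤ 1000 * Neg.Kq κ := by omega
  exact hπ2Y_YA_gen₂ κ Φ t p D c mk g f hN hκ hnA hℓA hSF yL hyl hNr' qB r hr

/-- **M3 y′-face field `hπ3Y` at hp-8's counts, origin size `YbF + 11·n_L`** (`Nr := NrY`, `N₃ := N3Y`). [cite: KozmaNitzan2024, §4 Lemma 12 (pp. 23–25)] -/
theorem hπ3Y_YA₂ (hN : EqNumL κ Φ t p D g f) (hκ : (hL κ Φ t p D g f).natAbs ≤ 10 * nL κ Φ t p D g f)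
    (hnA : 2000 * Neg.Kq κ * (RA' κ Φ t p D mk + 2) ≤ nL κ Φ t p D g f) (hℓA : 22000 * Neg.Kq κ * (RA' κ Φ t p D mk + 2) ≤ ℓL κ Φ t p D g f)
    (hSF : 16 * SF κ Φ t p D c mk ≤ ML κ Φ t p D g)
    (x : Site 2) (du : MDir) (hd : du.1 = 1) (j : ℕ) (hj : j < (fcellsA κ Φ t p D g f).K) (z : Site 2) {E : ℕ} {kE : ℤ}
    (hlev1 : (fcellsA κ Φ t p D g f).faceL 1 j - E ≤ (fcellsA κ Φ t p D g f).lev du x z) (hlev2 : (fcellsA κ Φ t p D g f).lev du x z ≤ (fcellsA κ Φ t p D g f).faceL 1 j + E)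
    (hz : |z 0 - (fcellsA κ Φ t p D g f).cen x 0| ≤ kE) (hEu : (E : ℤ) ≤ u₁A κ Φ t p D g f) (hkE : kE ≤ 5 * ((fcellsA κ Φ t p D g f).r 0 : ℤ))
    (yL : Site 2) (he0 : |FcA κ Φ t p D g f yL| ≤ 6 * u₀A κ Φ t p D g f) (he1 : |F1cA κ Φ t p D g f yL| ≤ 6 * u₁A κ Φ t p D g f)
    (hyl : (yL 0).natAbs + (yL 1).natAbs ≤ YbF κ Φ t p D c mk g f + 11 * nL κ Φ t p D g f) (r : ℕ) (hr : ∀ X : ℕ, X + 1 ≤ exA κ Φ t p D g f → X ≤ r) :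
    (((yL + crossOffY (nL κ Φ t p D g f) (ℓL κ Φ t p D g f) (hL κ Φ t p D g f) (vL κ Φ t p D g f) (sgOf du) (NrY κ Φ t p D g f yL x du z)) 0).natAbs +
        ((yL + crossOffY (nL κ Φ t p D g f) (ℓL κ Φ t p D g f) (hL κ Φ t p D g f) (vL κ Φ t p D g f) (sgOf du) (NrY κ Φ t p D g f yL x du z)) 1).natAbs) +
      (N3Y κ Φ t p D g f yL x z + 1) * shearUnit (nL κ Φ t p D g f) (hL κ Φ t p D g f) ≤ r := by
  have hu0 : 1 ≤ u₀A κ Φ t p D g f := (units_eqA κ Φ t p D g f).2.2.2.2.2.2.1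
  have hu1 : 1 ≤ u₁A κ Φ t p D g f := (units_eqA κ Φ t p D g f).2.2.2.2.2.2.2
  obtain ⟨-, hNr⟩ := NrY_range κ Φ t p D g f x du hd z hj hlev1 hlev2 yL he1 (by linarith)
  have hN3 := N3Y_range κ Φ t p D g f yL x z hz hkE he0 (by linarith)
  obtain ⟨-, hNr', hN3'⟩ := capY_of_ranges κ hNr hN3
  exact hπ3Y_YA_gen₂ κ Φ t p D c mk g f hN hκ hnA hℓA hSF du yL hyl hNr' hN3' r hr

end PiY2

end KS

end NegB

end PlanarSkeletonNeg

end Summit.CriticalPhenomena.PercolationContinuityZ3.Theorems.Transplant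

end
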